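import Summits.ValiantsHypothesis.ValiantsHypothesis.Theorems.LacunarySymmetroidMatrixDescartesJunctionCeilingSeamB

/-!
# Deliverable (B), val-idea-5 gen 2 — the JUNCTION CEILING: «does a graft / junction add at most ONE real root over the
# patchwork (additive) count?»  Typed three ways; the literal «+1» is REFUTED in the kernel (m = 2), the nonsingular core is
# the ONE structural stub.

HONEST FRAMING.  Ideator sketch (D-0148 (a) seat val-idea-5 g2, lens «symbolic-evo on the census»), crux `MatrixDescartes`
(stmt-ValiantsHypothesis-18050); requested by director-valiant g10 (bus l.9633 (d)) as the upgrade path of the LAW-tier line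
«unit-subtropical» (`ζ_sym ≤ T_gen + 1`): «TYPE the junction lemma ‹a graft adds ≤ 1 real root over the patchwork (tropical) count›
as ONE kernel statement over the tree's graft/patchwork vocabulary, with its cheapest falsifier».  NOT registered, no `skeleton check`.
Nothing here is a theorem about `MatrixDescartes`, `DoorA26`, Conjecture B or VP ≠ VNP; the one `sorry` is the structural stub
`stub_kernelDefiniteJunction`; the refutations `not_seamPlusOne_two`, `not_seamCeiling_two_one`, the leak example and the reduction
`nonsingularJunctionAdditive_of_kernelDefinite` are sorry-free.

THE OBJECT (the tree's junction vocabulary, `Census.Chain.exists_alternating_junction`).  `P = ∑ X^{d l} • S l` (`K₁+1` letters,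
strictly increasing support, TOP letter `J = S last` at exponent `a = d last`), `Q = ∑ X^{e l} • T l` (`K₂+1` letters, BOTTOM letter
`T 0 = J` at exponent `b = e 0`), and the junction pencil at scale `Λ`:
  `H_Λ = P + ∑_{l ≥ 1} Λ^{-(e l − b)} X^{a + e l − b} • T l`   (`K₁ + K₂ + 1` letters; the kernel's `exists_alternating_junction` shape,
indexed here by `Fin (K₁+1) ⊕ Fin K₂` instead of `Fin.append`).  The kernel proves the FLOOR `ζ(H_Λ) ≥ ζ_alt(P) + ζ_alt(Q)` (eventually
in `Λ`) and drops the seam point.  «Patchwork count» := the additive count `ζ•(P) + ζ•(Q)` (positive roots WITH multiplicity, so that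
root splitting is not miscounted); the question is the CEILING: how many roots can the SEAM (and the far ends) add?

RESULTS OF THIS FILE.
* `SeamPlusOne m` — the director's sentence typed literally: for a SINGULAR nonzero junction letter (`J ≠ 0`, `det J = 0`; corank one
  when `m = 2`) the junction has eventually `ζ(H_Λ) ≤ ζ•(P) + ζ•(Q) + 1`.  **REFUTED at `m = 2`: `not_seamPlusOne_two`** (kernel, sorry-free):
  `P = diag(0,1) + [[0,1],[1,0]]·X³ + diag(1,0)·X⁴` (`det P = X⁴ − X⁶`, one positive root), `Q = diag(1,0) + [[0,−1],[−1,0]]·X + diag(0,1)·X³`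
  (`det Q = X³ − X²`, one positive root), and `det H_Λ = X⁴ − X⁶ + 2Λ⁻¹X⁸ − Λ⁻²X¹⁰ + Λ⁻³X¹¹` alternates `+,−,+,−,+` at
  `½, 2, √Λ, 2√Λ, 2Λ` for every `Λ ≥ 16`: FOUR roots = 1 + 1 + 2.  Mechanism: at a corank-one seam `det H ≈ x^a·J₁₁·H₂₂ − H₁₂²`; the
  square `H₁₂² = (x³ − Λ⁻¹x⁵)²` has a DOUBLE zero inside the seam (`x₀ = √Λ`) which the lower-order positive term `x^a H₂₂` opens into
  TWO simple zeros — the symmetric-design «tied Leibniz terms» phenomenon (Li–Wang / the census's `(2,4): 9 > 8`) in its smallest instance.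
  So «+1 per graft/junction» is NOT a mechanism: a corank-one seam carries up to `m = 2` roots (exact Sturm search over 8 000 random
  `2 × 2` junctions, `seam/search_excess2.py`: maximal seam excess 2, attained; never 3).
* `KernelDefiniteJunction m` — **the ONE structural stub** (`stub_kernelDefiniteJunction`, non-law, plausibly TRUE): far ends nonsingular and
  the two SEAM NEIGHBOURS (letter of `P` just below `J`, letter of `Q` just above it) definite on `ker J` («non-silent seam») ⇒ eventually
  `ζ(H_Λ) ≤ ζ•(P) + ζ•(Q) + corank J`.  Corank one = the director's sentence made true («a graft through a corank-one letter adds ≤ 1 root over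
  the patchwork count, unless the seam is silent»); rank `m` = ADDITIVITY, derived sorry-free as `NonsingularJunctionAdditive m`
  (`nonsingularJunctionAdditive_of_kernelDefinite`): the kernel's junction FLOOR through nonsingular letters is also the CEILING — scale-separated
  recombination of nonsingular-ended certificates is EXACTLY additive (all 4 seeds of the `m = 2` register, `T14 G18 C22 G25`, have integer
  letters of exact rank 2 with DEFINITE end letters, so `28@(2,9) = 14 + 14` is the ceiling of `T14 ⋈ T14♯` in the limit, not just its floor).
  DATA (cheapest falsifier, run: `seam/search_excess4.py`, 12 155 random `2 × 2` junctions, entries in {−2..2}, ≤ 4+4 letters, Λ = 2²⁴, `P•,Q•`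
  by exact Sturm with multiplicity, `ζ(H)` by sign alternations on a 2^{1/6}-grid): max excess `ζ(H) − P• − Q•` by class —
  rank J = 2, ends nonsingular: **0** · rank J = 2, a rank-one far end: 1 (leak) · corank 1, ends nonsingular, seam non-silent: **1** ·
  corank 1, one silent side: 1 · corank 1, BOTH sides silent: **2** (the tie) · corank 1 with singular ends: 1.  No class exceeds `corank + #leaky ends`
  except the doubly-silent seam (= the refuting examples below), and nothing exceeds 2.
* `zeroLeak_example` (kernel, sorry-free): the far-end hypothesis is needed — nonsingular `J = diag(1,−1)` but a RANK-ONE bottom letter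
  `[[1,1],[1,1]]`: `det P = −X⁶` (no positive root), `det Q = X − 1` (one), and `det H_Λ = −X⁶ + Λ⁻¹X⁴ + Λ⁻¹X⁷` has TWO positive roots
  (one LEAKS out of `x = 0` at `x ≈ Λ^{-1/2}`).
* `SeamCeiling m c` — the ceiling with nonsingular far ends and ARBITRARY junction letter: **`SeamCeiling 2 1` REFUTED in the kernel**
  (`not_seamCeiling_two_one`: same seam, far ends `diag(1/8,1)` / `diag(1/8,−1)`, THREE roots = 1 + 0 + 2); conjecture `SeamCeiling m m`
  (m = 2: random search never exceeds 2) — OPEN, not stubbed (it would be a law-tier item; only the additive core is stubbed).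

WHAT IT SAYS ABOUT THE LAWS (honest).  (i) The `+1` of «unit-subtropical» (`ζ_sym ≤ T_gen + 1`) is NOT a per-junction constant; in the
scale-separated idealisation every extra root sits at a SINGULAR (in the census: near-singular, κ ~ 10⁻⁹…10⁻¹³ — desk R2391) letter: seams
carry ≤ m (m = 2 data), rank-one far ends leak ≤ 1 each; nonsingular recombination is additive.  This is the Λ → ∞ shadow of the cell's
located «RANK-ONE WINDOW LAW» and says the law-deciding objects are the SEEDS, not the junctions — consistent with both PASS-WITH-PRICE
verdicts (instruments = seed hunt / exact T_gen(3,5)).  (ii) NEW FLOOR TOOLS the kernel's Chain toolbox lacks, each a typed eventual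
construction: DEFECTIVE JUNCTION (+2 at m = 2 through a corank-one letter whose neighbours have zero kernel-compression and opposite
off-diagonal signs — `not_seamPlusOne_two` is its smallest certificate) and LEAKY END (+1 per rank-one far-end letter).  PREDICTIONS they
put on the row law «eleven-thirds» (`⌊11(K−1)/3⌋`, junction-closed under ADDITIVE junctions only): a (2,5) pencil with 13 roots, a
positive-defective top AND leaky ends would give `13 + 13 + 2 + 2 = 30 > 29` at (2,9) — so PRED-e11/3 implies «no 13-root (2,5) pencil is
defective-and-leaky», «no 14-root (2,5) pencil has a rank-one end or a positive-defective top» (each alone gives 29 or 30); the register's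
seeds are all rank-2-ended (checked from the kernel data), consistent.  Cheapest experiment (engines, not this seat): re-run the (2,5)/(2,6)
seed hunts CONSTRAINED to a rank-one end letter / a defective top and read the junction bonus.  (iii) VP ≠ VNP is not moved.
[folklore] throughout (continuity of roots, Descartes' rule with multiplicity = Mathlib `roots_countP_pos_le_signVariations`).

STATUS rev 3 (2026-08-28, REWIRED to the tree — val-port-4 g1 for the val-lit merged desk g11, RULING #241 (c); line content UNCHANGED).
rev 2 (tenure g11, @48ff5251ab7a) closed the ONE stub by name: `stub_kernelDefiniteJunction := …Theorems…JunctionCeiling.kernelDefiniteJunction`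
(val-width-18050-kj1 g0, p604951) — the file has ZERO sorries since.  rev 3: the whole deliverable is ported to `Theorems/` BY NAME —
(JA) `…LacunarySymmetroidMatrixDescartesJunctionCeilingSeamDefs` (p609023: `posD`, `posM`, `pencil`, `junction`, `SeamPlusOne`,
`NonsingularJunctionAdditive`, `SeamCeiling`, `KernelDefiniteJunction`, `KernelNonsilentJunction`), (JB) `…JunctionCeilingSeam` (p609597:
`kernelDefiniteJunction_holds`, `nonsingularJunctionAdditive_of_kernelDefinite`, `nonsingularJunctionAdditive_holds`,
`kernelDefiniteJunction_of_nonsilent`, `posM_le_one_of_binomial`, witness `SeamTwo`, `not_seamPlusOne_two`), (JC) `…JunctionCeilingSeamB`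
(p610139: witness `SeamTwoNonsingular`, `not_seamCeiling_two_one`, witness `Leak`, `zeroLeak_example`), all in namespace
`Summit.ValiantsHypothesis.ValiantsHypothesis.Theorems.LacunarySymmetroidMatrixDescartes.JunctionCeiling`.  This file now IMPORTS them: the
§1/§2/§8 definitions are RE-EXPORTED from that namespace (so `JunctionCeiling.posD`, `.junction`, `.KernelDefiniteJunction`, … still
resolve here and for any `open` user), the three witness namespaces re-export their data and lemmas, and every headline theorem keeps its
signature TOKEN-FOR-TOKEN with a by-name body.  Sorries 0 → 0; nothing registered changes (this line is not the crux's skeleton).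
-/

set_option linter.dupNamespace false
set_option autoImplicit false

namespace Summit.ValiantsHypothesis.ValiantsHypothesis.Cruxes.MatrixDescartes.JunctionCeiling

open Polynomial Finset Filter
open scoped BigOperators

/-! ## 1.–2. Vocabulary (`posD`, `posM`, `pencil`, `junction`) and the three typed ceilings + the kernel-definite law — rev 3: RE-EXPORTED
from the tree (`…Theorems.LacunarySymmetroidMatrixDescartes.JunctionCeiling`, JA p609023; texts identical to rev 1/2's local copies). -/

export Summit.ValiantsHypothesis.ValiantsHypothesis.Theorems.LacunarySymmetroidMatrixDescartes.JunctionCeiling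
  (posD posM pencil junction SeamPlusOne NonsingularJunctionAdditive SeamCeiling KernelDefiniteJunction)

/-- rev-3 probe: the re-exported names are the tree's declarations (by `rfl`). -/
example : @JunctionCeiling.junction = @Summit.ValiantsHypothesis.ValiantsHypothesis.Theorems.LacunarySymmetroidMatrixDescartes.JunctionCeiling.junction ∧
    JunctionCeiling.KernelDefiniteJunction = Summit.ValiantsHypothesis.ValiantsHypothesis.Theorems.LacunarySymmetroidMatrixDescartes.JunctionCeiling.KernelDefiniteJunction :=
  ⟨rfl, rfl⟩

/-- THE STUB (non-law, structural) — a THEOREM of the tree since rev 2: `…Theorems…JunctionCeiling.kernelDefiniteJunction`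
(val-width-18050-kj1 g0, p604951; vocabulary unfolded there, re-folded as `kernelDefiniteJunction_holds` in JB p609597). -/
theorem stub_kernelDefiniteJunction (m : ℕ) : KernelDefiniteJunction m := by
  -- rev (tenure g11, 2026-08-28, desk P6 (2) / director R73–R105 stub credit): THEOREM — landed as
  -- `Theorems/LacunarySymmetroidMatrixDescartesKernelDefiniteJunction.lean` (val-width-18050-kj1 g0); vocabulary unfolded there.
  exact Summit.ValiantsHypothesis.ValiantsHypothesis.Theorems.LacunarySymmetroidMatrixDescartes.JunctionCeiling.kernelDefiniteJunction m

/-- Nonsingular junction letters have trivial kernel and full rank: the additive ceiling is the rank-`m` case of the stub (kernel-checked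
reduction; no sorry of its own; rev 3: tree `…JunctionCeiling.nonsingularJunctionAdditive_of_kernelDefinite`, JB). -/
theorem nonsingularJunctionAdditive_of_kernelDefinite (m : ℕ) (h : KernelDefiniteJunction m) :
    NonsingularJunctionAdditive m :=
  Summit.ValiantsHypothesis.ValiantsHypothesis.Theorems.LacunarySymmetroidMatrixDescartes.JunctionCeiling.nonsingularJunctionAdditive_of_kernelDefinite m h

/-- so the additive ceiling carries no sorry of its own beyond the one stub (rev 3: = tree `…JunctionCeiling.nonsingularJunctionAdditive_holds`,
JB p609597 — NONSINGULAR JUNCTIONS ARE ADDITIVE for every `m`). -/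
theorem stub_nonsingularJunctionAdditive (m : ℕ) : NonsingularJunctionAdditive m :=
  nonsingularJunctionAdditive_of_kernelDefinite m (stub_kernelDefiniteJunction m)

/-! ## 3. Tools: Descartes with multiplicity for binomials (rev 3: tree, JB) -/

/-- At most one positive root, with multiplicity, for a nonzero binomial. [folklore] -/
theorem posM_le_one_of_binomial {p : ℝ[X]} (k n : ℕ) (x y : ℝ) (hp : p = C x * X ^ k + C y * X ^ n) (hp0 : p ≠ 0) :
    posM p ≤ 1 :=
  Summit.ValiantsHypothesis.ValiantsHypothesis.Theorems.LacunarySymmetroidMatrixDescartes.JunctionCeiling.posM_le_one_of_binomial k n x y hp hp0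

/-! ## 4. The kernel refutation of «+1»: a corank-one junction with seam excess TWO (m = 2) — rev 3: witness `SeamTwo` re-exported from JB -/

namespace SeamTwo
export Summit.ValiantsHypothesis.ValiantsHypothesis.Theorems.LacunarySymmetroidMatrixDescartes.JunctionCeiling.SeamTwo
  (dP SP eQ TQ dP_strictMono eQ_strictMono SP_symm TQ_symm TQ_zero J_ne_zero J_det detP_eq detQ_eq detP_ne_zero detQ_ne_zero posM_P posM_Q eval_detH val_half val_two val_t val_2t val_2Λ four_le_posD)
end SeamTwo

/-- **«+1 per junction» is false at `m = 2`.** (rev 3: tree `…JunctionCeiling.not_seamPlusOne_two`, JB p609597) -/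
theorem not_seamPlusOne_two : ¬ SeamPlusOne 2 :=
  Summit.ValiantsHypothesis.ValiantsHypothesis.Theorems.LacunarySymmetroidMatrixDescartes.JunctionCeiling.not_seamPlusOne_two

/-! ## 4b. «+1» is dead EVEN WITH NONSINGULAR FAR ENDS: `¬ SeamCeiling 2 1` — rev 3: witness `SeamTwoNonsingular` re-exported from JC -/

namespace SeamTwoNonsingular
export Summit.ValiantsHypothesis.ValiantsHypothesis.Theorems.LacunarySymmetroidMatrixDescartes.JunctionCeiling.SeamTwoNonsingular
  (dP SP eQ TQ dP_strictMono eQ_strictMono SP_symm TQ_symm TQ_zero S0_det Tlast_det detP_eq eval_detQ detP_ne_zero detQ_ne_zero posM_P posM_Q eval_detH val_half val_two val_t val_2t three_le_posD)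
end SeamTwoNonsingular

/-- **`SeamCeiling 2 1` is false**: three roots = 1 + 0 + 2 with nonsingular far ends. (rev 3: tree `…JunctionCeiling.not_seamCeiling_two_one`,
JC p610139) -/
theorem not_seamCeiling_two_one : ¬ SeamCeiling 2 1 :=
  Summit.ValiantsHypothesis.ValiantsHypothesis.Theorems.LacunarySymmetroidMatrixDescartes.JunctionCeiling.not_seamCeiling_two_one

/-! ## 5. The far-end hypothesis is needed: a root LEAKS out of `x = 0` through a rank-one bottom letter — rev 3: witness `Leak` re-exported
from JC -/

namespace Leak
export Summit.ValiantsHypothesis.ValiantsHypothesis.Theorems.LacunarySymmetroidMatrixDescartes.JunctionCeiling.Leak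
  (dP SP eQ TQ detP_eq detQ_eq posM_P posM_Q eval_detH two_le_posD)

/-- **LEAK**: nonsingular junction letter, rank-one far end: eventually-always `ζ(H_Λ) ≥ ζ•(P) + ζ•(Q) + 1`. (rev 3: tree
`…JunctionCeiling.Leak.zeroLeak_example`, JC p610139) -/
theorem zeroLeak_example (t : ℝ) (ht : 2 ≤ t) :
    posM (pencil dP SP).det + posM (pencil eQ TQ).det + 1 ≤ posD (junction 1 1 dP SP eQ TQ (t ^ 2)).det :=
  Summit.ValiantsHypothesis.ValiantsHypothesis.Theorems.LacunarySymmetroidMatrixDescartes.JunctionCeiling.Leak.zeroLeak_example t ht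

end Leak

/-! ## 8. (v2 appendix) NON-SILENT far ends — rev 3: `KernelNonsilentJunction` re-exported from JA; monotonicity by name (JB) -/

export Summit.ValiantsHypothesis.ValiantsHypothesis.Theorems.LacunarySymmetroidMatrixDescartes.JunctionCeiling (KernelNonsilentJunction)

/-- Monotonicity (kernel-checked, no sorry): nonsingular far ends are non-silent vacuously, so the sharpened statement implies the
booked stub `KernelDefiniteJunction`. [folklore] (rev 3: tree `…JunctionCeiling.kernelDefiniteJunction_of_nonsilent`, JB p609597) -/
theorem kernelDefiniteJunction_of_nonsilent (m : ℕ) (h : KernelNonsilentJunction m) : KernelDefiniteJunction m :=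
  Summit.ValiantsHypothesis.ValiantsHypothesis.Theorems.LacunarySymmetroidMatrixDescartes.JunctionCeiling.kernelDefiniteJunction_of_nonsilent m h

end Summit.ValiantsHypothesis.ValiantsHypothesis.Cruxes.MatrixDescartes.JunctionCeiling
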